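import Literature.Probability.LatticeModels.SharpLengthDCPProofs
import Literature.Probability.LatticeModels.SusceptibilityMeanFieldBound
import Literature.Probability.LatticeModels.CriticalTwoPointBounds
import Literature.Probability.LatticeModels.GriffithsMonotonicity
import Literature.Probability.LatticeModels.PlusStateFKG
import HarnessLib

/-!
# `φ_{β_c}(Λ_n) ≤ C n` on `ℤ³`: the box flux grows at most linearly (`κ ≤ 1`)

Helper for the crux `CoerciveSharpness.PhiCoercive` (stmt-CriticalPhenomena-18196), line
`box-superset`, stub `stub_boxFluxUpper`.

The Duminil-Copin–Panis flux of a finite `S ⊂ ℤ^d` is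
`φ_β(S) = β Σ_{x ∈ S} #{y ∉ S : y ∼ x} ⟨σ₀σ_x⟩^free_{S,β}` (`dcpPhi`, Def. 1.1 of
Duminil-Copin–Panis 2025).  On the box `Λ_n = box d n` only the sites of the sphere
`∂Λ_n = {‖x‖_∞ = n}` have neighbours outside `Λ_n`, at most `2d` of them, and
`⟨σ₀σ_x⟩^free_{Λ_n,β} ≤ ⟨σ₀σ_x⟩^free_β ≤ ⟨σ₀σ_x⟩⁺_β` (Griffiths' monotonicity in the volume and the
free/plus comparison), whence

* `dcpPhi_box_le_sphereSum : φ_β(Λ_n) ≤ β · 2d · Σ_{y ∈ ∂Λ_n} ⟨σ₀σ_y⟩⁺_β` (any `d ≥ 1`, `β ≥ 0`);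

at `β = β_c(3)` the infrared bound `⟨σ₀σ_y⟩⁺_{β_c} ≤ C ‖y‖^{-(d-2)} = C/n` on `∂Λ_n`
(`criticalTwoPoint_bounds_holds`, Fröhlich–Simon–Spencer 1976 / Duminil-Copin 2019, Thm. 4.8) and
`#∂Λ_n ≤ 54 n²` (`card_sphere_succ_le`) give

* `stub_boxFluxUpper : ∃ C, ∀ n ≥ 1, φ_{β_c}(Λ_n) ≤ C n`.

So the growth exponent `κ` of `BoxCoercive` is at most `1` (mean-field surface scaling would give
`κ = 0`; the conjectured value on `ℤ³` is `1 − η_⊥ ≈ 0.2`).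
-/

noncomputable section

namespace Summit.CriticalPhenomena.Ising3DConformalLimit.Cruxes.PhiCoercive.BoxSuperset

open scoped BigOperators
open Finset
open Literature.Probability.LatticeModels

/-- **`φ_β(Λ_n)` is carried by the sphere**: `φ_β(Λ_n) ≤ β · 2d · Σ_{y ∈ ∂Λ_n} ⟨σ₀σ_y⟩⁺_β` for
`β ≥ 0`, `d ≥ 1` (only the sites of `∂Λ_n` have neighbours outside `Λ_n`, at most `2d` of them;
`⟨σ₀σ_x⟩^free_{Λ_n;β} ≤ ⟨σ₀σ_x⟩^free_β ≤ ⟨σ₀σ_x⟩⁺_β` by Griffiths' monotonicity in the volume and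
the free/plus comparison).  The `dcpPhi` analogue of the tree's `dctIsingPhi_box_le_sphereSum`
(same proof, without the factor `tanh β ≤ 1`). -/
theorem dcpPhi_box_le_sphereSum {d : ℕ} (hd : 1 ≤ d) {β : ℝ} (hβ : 0 ≤ β) (n : ℕ) :
    dcpPhi d β (box d n) ≤ β * (2 * d * ∑ y ∈ sphere d n, twoPointPlus d β y) := by
  classical
  unfold dcpPhi
  refine mul_le_mul_of_nonneg_left ?_ hβ
  have hmono : isingCorr_free_mono_volume (d := d) := isingCorr_free_mono_volume_holds
  have hlim : hasBoxLimit_isingCorr_free d := hasBoxLimit_isingCorr_free_holds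
  have hx_bound : ∀ x ∈ box d n,
      ((((zdGraph d).neighborFinset x).filter fun y => y ∉ box d n).card : ℝ) *
        isingTwoPoint (zdGraph d) (box d n) β 0 .free 0 x ≤
      if Site.supNorm x = n then 2 * d * twoPointPlus d β x else 0 := by
    intro x hx
    have h2pt0 : 0 ≤ isingTwoPoint (zdGraph d) (box d n) β 0 .free 0 x :=
      isingTwoPoint_free_nonneg' hβ (zero_mem_box d n) hx
    have h2pt : isingTwoPoint (zdGraph d) (box d n) β 0 .free 0 x ≤ twoPointPlus d β x :=
      (isingTwoPoint_free_le_twoPointFree hmono hlim hβ (zero_mem_box d n) hx).trans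
        (twoPointFree_le_twoPointPlus_holds hd hβ x)
    split_ifs with hxn
    · have hcard :
          ((((zdGraph d).neighborFinset x).filter fun y => y ∉ box d n).card : ℝ) ≤ 2 * d := by
        have h := (Finset.card_filter_le ((zdGraph d).neighborFinset x)
          (fun y => y ∉ box d n)).trans (card_neighborFinset_zdGraph_le x)
        exact_mod_cast h
      calc ((((zdGraph d).neighborFinset x).filter fun y => y ∉ box d n).card : ℝ) *
            isingTwoPoint (zdGraph d) (box d n) β 0 .free 0 x
          ≤ (2 * d : ℝ) * twoPointPlus d β x := mul_le_mul hcard h2pt h2pt0 (by positivity)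
        _ = 2 * d * twoPointPlus d β x := by ring
    · have hlt : Site.supNorm x < n := lt_of_le_of_ne (mem_box_iff_supNorm_le.1 hx) hxn
      have hempty : ((zdGraph d).neighborFinset x).filter (fun y => y ∉ box d n) = ∅ := by
        refine Finset.eq_empty_of_forall_notMem fun y hy => ?_
        obtain ⟨hy1, hy2⟩ := Finset.mem_filter.1 hy
        rw [SimpleGraph.mem_neighborFinset] at hy1
        exact hy2 (mem_box_of_adj_of_supNorm_lt hlt hy1)
      rw [hempty, Finset.card_empty]
      simp
  calc ∑ x ∈ box d n, ((((zdGraph d).neighborFinset x).filter fun y => y ∉ box d n).card : ℝ) *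
        isingTwoPoint (zdGraph d) (box d n) β 0 .free 0 x
      ≤ ∑ x ∈ box d n, (if Site.supNorm x = n then 2 * d * twoPointPlus d β x else 0) :=
        Finset.sum_le_sum hx_bound
    _ = 2 * d * ∑ y ∈ sphere d n, twoPointPlus d β y := by
        rw [← Finset.sum_filter, Finset.mul_sum]
        rfl

/-- `#∂Λ_n ≤ 54 n²` in `ℤ³` for `n ≥ 1` (from `#∂Λ_{k+1} ≤ 2·3·(2k+3)²` and `2k+3 ≤ 3(k+1)`). -/
theorem card_sphere_three_le {n : ℕ} (hn : 1 ≤ n) : (#(sphere 3 n) : ℝ) ≤ 54 * (n : ℝ) ^ 2 := by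
  obtain ⟨k, rfl⟩ : ∃ k, n = k + 1 := ⟨n - 1, by omega⟩
  have h := card_sphere_succ_le (d := 3) k
  have hk : (0 : ℝ) ≤ k := Nat.cast_nonneg k
  push_cast at h ⊢
  norm_num at h
  nlinarith [h, mul_nonneg hk hk, hk]

/-- A site on the sphere `∂Λ_n` with `n ≥ 1` is not the origin. -/
theorem ne_zero_of_mem_sphere {n : ℕ} (hn : 1 ≤ n) {y : Site 3} (hy : y ∈ sphere 3 n) : y ≠ 0 := by
  rintro rfl
  have h0 : Site.supNorm (0 : Site 3) = 0 := Site.supNorm_eq_zero_iff.2 rfl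
  have h := mem_sphere.1 hy
  omega

/-- **The infrared bound on the sphere**: at `β_c(3)`, `⟨σ₀σ_y⟩⁺_{β_c} ≤ C / n` for `y ∈ ∂Λ_n`,
`n ≥ 1`, with the constant `C` of `criticalTwoPoint_bounds` (`‖y‖ = ‖y‖_∞ = n`). -/
theorem twoPointPlus_criticalBeta_sphere_le :
    ∃ C : ℝ, 0 ≤ C ∧ ∀ n : ℕ, 1 ≤ n → ∀ y ∈ sphere 3 n,
      twoPointPlus 3 (criticalBeta 3) y ≤ C * (n : ℝ)⁻¹ := by
  obtain ⟨c, C, -, hbounds⟩ := criticalTwoPoint_bounds_holds (d := 3) (by norm_num)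
  refine ⟨max C 0, le_max_right _ _, fun n hn y hy => ?_⟩
  have hyn : Site.supNorm y = n := mem_sphere.1 hy
  have h2 := (hbounds y (ne_zero_of_mem_sphere hn hy)).2
  have hnorm : (‖y‖ : ℝ) = n := by rw [Site.norm_eq_supNorm, hyn]
  have hexp : (n : ℝ) ^ (-((((3 : ℕ) : ℝ)) - 2)) = (n : ℝ)⁻¹ := by
    norm_num [Real.rpow_neg_one]
  rw [hnorm, hexp] at h2
  calc twoPointPlus 3 (criticalBeta 3) y = criticalTwoPoint 3 y := rfl
    _ ≤ C * (n : ℝ)⁻¹ := h2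
    _ ≤ max C 0 * (n : ℝ)⁻¹ := mul_le_mul_of_nonneg_right (le_max_left _ _) (by positivity)

/-- **stub `stub_boxFluxUpper` (line `box-superset`, crux `PhiCoercive`): the box flux grows at
most linearly**, `∃ C, ∀ n ≥ 1, φ_{β_c}(Λ_n) ≤ C n` on `ℤ³` — so the exponent `κ` of
`BoxCoercive` satisfies `κ ≤ 1`.  Proof: `φ_{β_c}(Λ_n) ≤ β_c · 6 · Σ_{∂Λ_n} ⟨σ₀σ_y⟩⁺_{β_c}`
(`dcpPhi_box_le_sphereSum`), each term `≤ C/n` (infrared bound), `#∂Λ_n ≤ 54 n²`. -/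
theorem stub_boxFluxUpper : ∃ C : ℝ, ∀ n : ℕ, 1 ≤ n →
    dcpPhi 3 (criticalBeta 3) (box 3 n) ≤ C * n := by
  obtain ⟨C, hC, hsphere⟩ := twoPointPlus_criticalBeta_sphere_le
  have hβ : 0 ≤ criticalBeta 3 := criticalBeta_nonneg 3
  refine ⟨criticalBeta 3 * (6 * (54 * C)), fun n hn => ?_⟩
  have hn0 : (0 : ℝ) < n := by exact_mod_cast hn
  have hsum : ∑ y ∈ sphere 3 n, twoPointPlus 3 (criticalBeta 3) y ≤ 54 * (n : ℝ) ^ 2 * (C * (n : ℝ)⁻¹) :=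
    calc ∑ y ∈ sphere 3 n, twoPointPlus 3 (criticalBeta 3) y
        ≤ ∑ _y ∈ sphere 3 n, C * (n : ℝ)⁻¹ := Finset.sum_le_sum (hsphere n hn)
      _ = (#(sphere 3 n) : ℝ) * (C * (n : ℝ)⁻¹) := by rw [Finset.sum_const, nsmul_eq_mul]
      _ ≤ 54 * (n : ℝ) ^ 2 * (C * (n : ℝ)⁻¹) :=
          mul_le_mul_of_nonneg_right (card_sphere_three_le hn) (by positivity)
  calc dcpPhi 3 (criticalBeta 3) (box 3 n)
      ≤ criticalBeta 3 * (2 * (3 : ℕ) * ∑ y ∈ sphere 3 n, twoPointPlus 3 (criticalBeta 3) y) :=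
        dcpPhi_box_le_sphereSum (by norm_num) hβ n
    _ ≤ criticalBeta 3 * (2 * (3 : ℕ) * (54 * (n : ℝ) ^ 2 * (C * (n : ℝ)⁻¹))) := by gcongr
    _ = criticalBeta 3 * (6 * (54 * C)) * n := by
        field_simp
        ring

end Summit.CriticalPhenomena.Ising3DConformalLimit.Cruxes.PhiCoercive.BoxSuperset

end
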